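import Literature.Geometry.DiscreteGeometry.ThreePointEnergyBound
import Summits.Ventures.PackingBounds.Energy.ChebyshevUExplicit
import Summits.Ventures.PackingBounds.Energy.TenPointPetQ1SOS
import Summits.Ventures.PackingBounds.Energy.TenPointPetQ1Fsum
import Summits.Ventures.PackingBounds.Energy.TenPointPetQ1Bound
import HarnessLib

/-!
# Ten points on `S³`: the sharp bound `20588575/139968` for `Σ (1 + ⟪x,y⟫) ^ 7 * (⟪x,y⟫ + 2 / 3)` by an exact three-point certificate

Framing: lottery ticket; floor = certified bounds/negative ranges. Venture `PackingBounds`, cell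
`pub-packcert`, energy family E3PT (pub-packcert-energy gen 14; n = 4 kernel route = KERNEL-D6 data route + `threePointF 4`).

For every set `C` of ten unit vectors of `ℝ⁴`, `Σ_{x ≠ y} (1 + ⟪x,y⟫) ^ 7 * (⟪x,y⟫ + 2 / 3)` over ordered pairs is at least `20588575/139968`, the value of
Petersen code (4,10,1/6) (inner products `1/6` and `-2/3`). Cohn–Woo (J. AMS 2012, §5.3) report this case of their three-point bound as
numerically sharp; no proof or certificate is printed there. The proof here is an exact sharp Bachoc–Vallentin / Cohn–Woo
three-point certificate (rational: the optimal face is Galois-stable), kernel-checked: `CohnWoo.energy_ge_of_threePoint` (general `n`),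
`tripleSum_threePointF_nonneg` (`n = 4`), the blockwise identities `threePointF 4 … = FexpKPQ1` (closed forms `QFour.Q4_<k>`), the two-point part in
the basis `C_k^1 = U_k` (`ChebyshevU.c1_k`, k ≤ 6), the SOS identity of the companion files, and the PSD of the 77 × 77 Gram block by kernel
evaluation on integer data (KERNEL-D6 route).
Source certificate `pub-packcert-energy/certs/e3pt/e3pt-sharp-n4N10petq1d6-none.json`; generator `pub-packcert-energy/code/e3pt/g14/e3pt_lean_n4p.py`.
-/

noncomputable section

open Finset
open scoped RealInnerProductSpace

namespace Summit.Ventures.PackingBounds.Energy.TenPointPetQ1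

open Literature.Geometry.DiscreteGeometry Literature.Geometry.DiscreteGeometry.BachocVallentin
open Literature.Analysis.SpecialFunctions Summit.Ventures.PackingBounds.Energy

/-- Two-point coefficients in the tree's basis `C_k^1 = U_k` (`U_k(1) = k+1`): `a_k/(k+1)`. -/
def acoKPQ1 : ℕ → ℝ
  | 1 => aKPQ1 1 / 2
  | 2 => aKPQ1 2 / 3
  | _ => 0

/-- The two-point coefficients are nonnegative. -/
theorem aco_nonnegPQ1 (k : ℕ) : 0 ≤ acoKPQ1 k := by
  unfold acoKPQ1; split
  · exact div_nonneg (aK_nonnegPQ1 _) (by norm_num)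
  · exact div_nonneg (aK_nonnegPQ1 _) (by norm_num)
  · norm_num

/-- The rank-one weights are nonnegative. -/
theorem dco_nonnegPQ1 (k r : ℕ) : 0 ≤ dcoKPQ1 k r := by
  unfold dcoKPQ1; split
  · exact dco0B_nonnegPQ1 _
  · exact dco1B_nonnegPQ1 _
  · exact dco2B_nonnegPQ1 _
  · exact dco3B_nonnegPQ1 _
  · exact dco4B_nonnegPQ1 _
  · exact dco5B_nonnegPQ1 _
  · norm_num

/-- **Ten points on `S³` (sharp three-point bound).** For every ten unit vectors `C ⊂ ℝ⁴`, `Σ_{x ≠ y} (1 + ⟪x,y⟫) ^ 7 * (⟪x,y⟫ + 2 / 3)` over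
ordered pairs is `≥ 20588575/139968` — the value of Petersen code (4,10,1/6). -/
theorem petq1_ten_points (C : Finset (EuclideanSpace ℝ (Fin 4))) (hC : ∀ x ∈ C, ‖x‖ = 1)
    (h10 : C.card = 10) :
    ((20588575 : ℝ)/139968) ≤ ∑ x ∈ C, ∑ y ∈ C.erase x, (1 + inner ℝ x y) ^ 7 * (inner ℝ x y + 2 / 3) := by
  classical
  have hA := pairSum_gegenbauer_comb_nonneg (n := 4) (by norm_num) 6 acoKPQ1 aco_nonnegPQ1 C hC
  have hF := tripleSum_threePointF_nonneg (n := 4) le_rfl 6 6 dcoKPQ1 dco_nonnegPQ1 gwKPQ1 C hC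
  have hcard : (C.card : ℝ) = 10 := by exact_mod_cast h10
  have hAeval : ∀ w : ℝ, (∑ k ∈ range (6 + 1), acoKPQ1 k * gegenbauerSum ((((4 : ℕ) : ℝ) - 2) / 2) k w) = aPolyKPQ1 w := by
    intro w
    have hμ : ((((4 : ℕ) : ℝ) - 2) / 2) = (1 : ℝ) := by norm_num
    rw [hμ]
    have h0 : acoKPQ1 0 = 0 := rfl
    have h1 : acoKPQ1 1 = (((353406391072637082672119 : ℝ)/4095369037707646441881600)) / 2 := rfl
    have h2 : acoKPQ1 2 = (((258998761667710977714427 : ℝ)/3003270627652274057379840)) / 3 := rfl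
    have h3 : acoKPQ1 3 = 0 := rfl
    have h4 : acoKPQ1 4 = 0 := rfl
    have h5 : acoKPQ1 5 = 0 := rfl
    have h6 : acoKPQ1 6 = 0 := rfl
    simp only [Finset.sum_range_succ, Finset.sum_range_zero, h0, h1, h2, h3, h4, h5, h6, ChebyshevU.c1_0, ChebyshevU.c1_1, ChebyshevU.c1_2, ChebyshevU.c1_3, ChebyshevU.c1_4, ChebyshevU.c1_5, ChebyshevU.c1_6, aPolyKPQ1]
    ring
  have hineq : ∀ u v t : ℝ, -1 ≤ u → u < 1 → -1 ≤ v → v < 1 → -1 ≤ t → t < 1 →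
      0 ≤ 1 + 2 * u * v * t - u ^ 2 - v ^ 2 - t ^ 2 →
      c0KPQ1 + ((C.card : ℝ) - 2) * threePointF 4 6 6 dcoKPQ1 gwKPQ1 u v t + threePointF 4 6 6 dcoKPQ1 gwKPQ1 u u 1
        + threePointF 4 6 6 dcoKPQ1 gwKPQ1 v v 1 + threePointF 4 6 6 dcoKPQ1 gwKPQ1 t t 1
        + ((fun w => ∑ k ∈ range (6 + 1), acoKPQ1 k * gegenbauerSum ((((4 : ℕ) : ℝ) - 2) / 2) k w) u
          + (fun w => ∑ k ∈ range (6 + 1), acoKPQ1 k * gegenbauerSum ((((4 : ℕ) : ℝ) - 2) / 2) k w) v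
          + (fun w => ∑ k ∈ range (6 + 1), acoKPQ1 k * gegenbauerSum ((((4 : ℕ) : ℝ) - 2) / 2) k w) t) / 3
        ≤ (pminKPQ1 u + pminKPQ1 v + pminKPQ1 t) / 3 := by
    intro u v t hu1 hu2 hv1 hv2 ht1 ht2 hdet
    simp only [hAeval, hcard, threePointF_eqPQ1]
    have h1 := slack_nonnegPQ1 u v t
    linarith
  have key := CohnWoo.energy_ge_of_threePoint C hC (by omega) pminKPQ1 _ _ c0KPQ1 hA hF
    (threePointF_swap12 4 6 6 dcoKPQ1 gwKPQ1) (threePointF_swap23 4 6 6 dcoKPQ1 gwKPQ1) hineq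
  simp only [hAeval, hcard, threePointF_eqPQ1] at key
  have hfin : ∑ x ∈ C, ∑ y ∈ C.erase x, pminKPQ1 (inner ℝ x y) = ∑ x ∈ C, ∑ y ∈ C.erase x, (1 + inner ℝ x y) ^ 7 * (inner ℝ x y + 2 / 3) :=
    Finset.sum_congr rfl fun x _ => Finset.sum_congr rfl fun y _ => by simp only [pminKPQ1]; ring
  rw [hfin] at key
  linarith [key, bound_eqPQ1]

end Summit.Ventures.PackingBounds.Energy.TenPointPetQ1
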